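import Mathlib
import Literature.MathematicalPhysics.QuantumFieldTheory.MagnenRivasseauSeneor1993.MRS93BackgroundGaugeFixing
import HarnessLib

/-!
# Magnen–Rivasseau–Sénéor (CMP 155, 1993): (II.46)/(II.47) p.342 — the «ex nihilo» creation of the time component
# `A′₀`: the peaking factor `F(A′₀, γ)` and its normalisation `L_{0,ρ₁}(γ)`, typed on cut-off configurations with the
# peaking functional as a declared PARAMETER; the identity (II.46) `1 = L_{0,ρ₁}(γ) ∫ dμ F(A′₀, γ)` PROVED

statement-level skeleton of published definitions with citation tags; bookkeeping proved; nothing here is a claim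
about the Yang–Mills mass gap, about continuum Yang–Mills on `T⁴` without infrared cutoff, or about the Clay problem —
and nothing of Magnen–Rivasseau–Sénéor's analysis is asserted or formalised

**Citation header (reproduction of PUBLISHED work).** J. Magnen, V. Rivasseau, R. Sénéor, *Construction of YM₄ with
an infrared cutoff*, Commun. Math. Phys. **155** (1993) 325–383 [MagnenRivasseauSeneor1993], Sect. II.C p.342
tl.5–19 with (II.46), (II.47); (II.49) p.342 (the factor `L_{0,ρ₁}(γ)F(A′₀,γ)`, last line). Loci `p.NNN tl.nn` =
journal page / text-layer line of the held scan `paper:magnen1993-cmp155-mrs-ym4-infrared-cutoff` (PDF page = journal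
page − 324); display read on the decoded page image `run/shared/lean/pub/lit-balaban/inprint/lit-balaban-p14/
renders-cmp155/p18_full_s6.png`. Cell pub-balaban-gaps, track G3, seat mrs-lit-1 (gen 5); companion prose
`run/shared/lean/pub/pub-balaban-gaps/g3/MRS-AS-PRINTED.md` §2, §5. Builds on `…MRS93BackgroundGaugeFixing`
(`gcoeffZ`, `dCoeff`, `convCross`, `gaugeTrunc2Coeff` = (II.6) in momentum space), `…MRS93AxialYMAction` (`coeffZ`),
`…MRS93GaussianReferenceMeasures` (`muZeroPrime` = `dμ_{0,ρ₁}(A′)dμ_{C₀,ρ₁}(A′₀)` of (II.44)/(II.46)).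

**The print (p.342 tl.5–19).** «Our initial axial field A has only nine scalar components since A₀ was identically
0. We want that the special-gauge field A′ contains the usual twelve components. In fact one should have A′₀ =
∂₀^{γ,2} = ∂₀γ + (λ/2)[γ, ∂₀γ]. But since the change of variables γ → ∂₀γ is not invertible and we need to keep in
our formulas a functional integration over γ, it is convenient (although not necessary) to create the A′₀ field ex
nihilo by a functional formula which peaks it automatically around the desired value. This formula is
  1 = L_{0,ρ₁}(γ) ∫ dμ_{C₀,ρ₁}(A′₀) F(A′₀, γ),                                              (II.46)
  F(A′₀, γ) ≡ e^{− Σ_{Δ∈D_{ρ₁}} |Δ|⁻¹ ∫_Δ (A′₀ − ∂₀γ − 1/2 λ[γ, ∂₀γ])^{N′}},                    (II.47)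
where N′ is some large integer and L_{0,ρ₁} is the inverse of the integral in (II.46) so that (II.46) is true; it
is a slowly varying function of γ which can be integrated with the measure on γ in (II.37).»

**What is typed, and how (READINGS declared).**
* `dTrunc2Coeff` = `(∂^{γ,2})~_0(k)` = `(0^{γ,2})~_0(k)` (the (II.6) transform of the ZERO field, time component:
  `ik₀γ̃(k) + (λ/2) Σ_{q+r=k} γ̃(q) ×₃ (ir₀γ̃(r))`, PROVED equal to the printed `∂₀γ + (λ/2)[γ, ∂₀γ]` form,
  `dTrunc2Coeff_eq`); `peakDeviation` = the momentum coefficients of `A′₀ − ∂₀γ − (λ/2)[γ, ∂₀γ]` for a cut-off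
  twelve-component configuration `A′ : Config` (READING (X) of `…CountertermFunctional`: `Config` carries all four
  `μ`; the time component is `μ = 0`) and a cut-off `γ : GhostConfig`.
* READING (Y′) — the PEAKING FUNCTIONAL IS A PARAMETER. (II.47) raises an `su(2)`-valued field to the power `N′`
  («some large integer», parity not printed), averages over the cubes `Δ ∈ D_{ρ₁}` in POSITION space and sums; the
  norm/trace convention in `( · )^{N′}` is not printed. The file therefore carries the exponent as a functional
  `Q : ((ℤ⁴ → Fin 3 → ℂ) → ℝ)` of the deviation's coefficients, and the theorems use only `0 ≤ Q` (the peaking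
  exponent is nonnegative — the reading under which `F ≤ 1` «peaks») and continuity of `Q`. `peakFactor Q` =
  `F(A′₀, γ) = e^{−Q(deviation)}`.
* `Lnorm` = `L_{0,ρ₁}(γ)` := `(∫ F(A′₀, γ) dμ)⁻¹` «the inverse of the integral in (II.46)», against the tree's
  reference measure `muZeroPrime par ρ₁` on the twelve-component `A′` (which the tree's docstring describes as
  `dμ_{0,ρ₁}(A′)dμ_{C₀,ρ₁}(A′₀)`; integrating the `A′₀`-function `F` against the full product is integrating it against
  its `A′₀`-marginal).
* PROVED: `0 < F ≤ 1`, `F` continuous/measurable in `A′`, integrable; `0 < ∫F dμ ≤ 1`; **(II.46) `L_{0,ρ₁}(γ) · ∫ F dμ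
  = 1`** (`Lnorm_mul_integral_peakFactor`) and `1 ≤ L_{0,ρ₁}(γ)` — «so that (II.46) is true» holds for every `γ`,
  every window, every nonneg continuous `Q`.

**Honest status / what is NOT claimed.** The concrete (II.47) exponent (cube averages of an `N′`-th power in position
space) is NOT constructed — `Q` is a parameter; «it is a slowly varying function of γ» and «the field A′₀ coincides
very accurately at scale ρ₂ with the desired expression» (p.342 tl.15–19) are analytic claims of the paper, not typed;
nothing here constrains `PinnedTheory.law`, nothing makes (II.49)/(II.78) normalisable; nothing about Bałaban.
-/

noncomputable section

open MeasureTheory Finset Complex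
open scoped NNReal ENNReal ComplexConjugate Matrix

namespace Literature.MathematicalPhysics.QuantumFieldTheory.MagnenRivasseauSeneor1993

namespace MainStatement

open Ansatz

/-! ## §1 The desired value `∂₀^{γ,2} = ∂₀γ + (λ/2)[γ, ∂₀γ]` and the deviation `A′₀ − ∂₀^{γ,2}` -/

/-- **`(∂^{γ,2})~_0(k)`** — the time component of the (II.6) transform of the ZERO field: `(0^{γ,2})~_0(k)`, i.e. the
momentum coefficients of «∂₀^{γ,2} = ∂₀γ + (λ/2)[γ, ∂₀γ]» (p.342 tl.7), for a cut-off `γ` given by its coefficient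
function `G` supported in `T`. [cite: MagnenRivasseauSeneor1993, p.342 tl.7, (II.6) p.329] -/
def dTrunc2Coeff (T : Finset (Fin 4 → ℤ)) (lam : ℝ) (G : (Fin 4 → ℤ) → Fin 3 → ℂ) (k : Fin 4 → ℤ) : Fin 3 → ℂ :=
  gaugeTrunc2Coeff T lam 0 G 0 k

/-- `(∂^{γ,2})~_0(k) = ik₀γ̃(k) + (λ/2) Σ_{q+r=k} γ̃(q) ×₃ (ir₀ γ̃(r))` — the printed «∂₀γ + (λ/2)[γ, ∂₀γ]» (the
`A`-dependent terms of (II.6) vanish on the zero field). [cite: MagnenRivasseauSeneor1993, p.342 tl.7, (II.6) p.329] -/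
theorem dTrunc2Coeff_eq (T : Finset (Fin 4 → ℤ)) (lam : ℝ) (G : (Fin 4 → ℤ) → Fin 3 → ℂ) (k : Fin 4 → ℤ) :
    dTrunc2Coeff T lam G k = dCoeff G 0 k + ((lam / 2 : ℝ) : ℂ) • convCross (insert 0 T) G (dCoeff G 0) k := by
  unfold dTrunc2Coeff gaugeTrunc2Coeff
  have h0 : convCross (insert 0 T) (fun q => (0 : (Fin 4 → ℤ) → Fin 4 → Fin 3 → ℂ) q 0) G k = 0 := by
    unfold convCross
    refine sum_eq_zero fun q _ => sum_eq_zero fun r _ => ?_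
    split_ifs
    · ext a
      fin_cases a <;> simp [crossProduct]
    · rfl
  rw [h0, smul_zero, sub_zero]
  ext a
  simp

/-- **The peaking deviation `(A′₀ − ∂₀γ − (λ/2)[γ, ∂₀γ])~(k)`** of (II.47) for a cut-off twelve-component
configuration `A′` (time component `μ = 0`, window `S`) and a cut-off `γ` (window `Sγ`).
[cite: MagnenRivasseauSeneor1993, (II.47) p.342 tl.13, p.342 tl.7] -/
def peakDeviation (S Sγ : Finset Momentum) (lam : ℝ) (A' : Config) (γ : GhostConfig) (k : Fin 4 → ℤ) :
    Fin 3 → ℂ :=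
  coeffZ S A' k 0 - dTrunc2Coeff (Sγ.image Subtype.val) lam (gcoeffZ Sγ γ) k

/-- The deviation vanishes exactly when `Ã′₀ = (∂₀^{γ,2})~` coefficientwise — «one should have A′₀ = ∂₀^{γ,2}».
[cite: MagnenRivasseauSeneor1993, p.342 tl.7] -/
theorem peakDeviation_eq_zero_iff (S Sγ : Finset Momentum) (lam : ℝ) (A' : Config) (γ : GhostConfig) :
    peakDeviation S Sγ lam A' γ = 0 ↔
      ∀ k, coeffZ S A' k 0 = dTrunc2Coeff (Sγ.image Subtype.val) lam (gcoeffZ Sγ γ) k := by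
  unfold peakDeviation
  constructor
  · intro h k
    have hk := congrFun h k
    simpa [sub_eq_zero] using hk
  · intro h
    funext k
    simp [h k]

/-- For fixed `γ`, the deviation is continuous in `A′` (each coefficient is an affine function of finitely many
coordinates). [cite: MagnenRivasseauSeneor1993, (II.47) p.342] -/
theorem continuous_peakDeviation (S Sγ : Finset Momentum) (lam : ℝ) (γ : GhostConfig) :
    Continuous fun A' : Config => peakDeviation S Sγ lam A' γ := by
  unfold peakDeviation
  refine continuous_pi fun k => continuous_pi fun a => ?_
  exact (continuous_coeffZ S k 0 a).sub continuous_const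

/-! ## §2 (II.47) `F(A′₀, γ)` with the peaking functional as a parameter (READING (Y′)) -/

/-- **(II.47), `F(A′₀, γ) = e^{−Q(A′₀ − ∂₀γ − (λ/2)[γ, ∂₀γ])}`**, the peaking exponent `Q` («Σ_{Δ∈D_{ρ₁}} |Δ|⁻¹ ∫_Δ
( · )^{N′}», `N′` «some large integer») carried as a functional PARAMETER of the deviation's coefficients (READING
(Y′)). [cite: MagnenRivasseauSeneor1993, (II.47) p.342 tl.13–15] -/
def peakFactor (Q : ((Fin 4 → ℤ) → Fin 3 → ℂ) → ℝ) (S Sγ : Finset Momentum) (lam : ℝ) (A' : Config)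
    (γ : GhostConfig) : ℝ :=
  Real.exp (-Q (peakDeviation S Sγ lam A' γ))

variable {Q : ((Fin 4 → ℤ) → Fin 3 → ℂ) → ℝ}

/-- `0 < F(A′₀, γ)`. [cite: MagnenRivasseauSeneor1993, (II.47) p.342] -/
theorem peakFactor_pos (Q : ((Fin 4 → ℤ) → Fin 3 → ℂ) → ℝ) (S Sγ : Finset Momentum) (lam : ℝ) (A' : Config)
    (γ : GhostConfig) : 0 < peakFactor Q S Sγ lam A' γ :=
  Real.exp_pos _

/-- `F(A′₀, γ) ≤ 1` for a nonnegative peaking exponent («peaks it automatically around the desired value»).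
[cite: MagnenRivasseauSeneor1993, (II.47) p.342 tl.9–10] -/
theorem peakFactor_le_one (hQ : ∀ X, 0 ≤ Q X) (S Sγ : Finset Momentum) (lam : ℝ) (A' : Config) (γ : GhostConfig) :
    peakFactor Q S Sγ lam A' γ ≤ 1 := by
  unfold peakFactor
  rw [Real.exp_le_one_iff]
  have h := hQ (peakDeviation S Sγ lam A' γ)
  linarith

/-- `F(A′₀, γ) = 1` (the maximum) AT the desired value `A′₀ = ∂₀^{γ,2}`, whenever `Q 0 = 0`.
[cite: MagnenRivasseauSeneor1993, (II.47) p.342 tl.9–10] -/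
theorem peakFactor_eq_one_of_deviation_eq_zero (hQ0 : Q 0 = 0) (S Sγ : Finset Momentum) (lam : ℝ) (A' : Config)
    (γ : GhostConfig) (h : peakDeviation S Sγ lam A' γ = 0) : peakFactor Q S Sγ lam A' γ = 1 := by
  unfold peakFactor
  rw [h, hQ0, neg_zero, Real.exp_zero]

/-- For fixed `γ` and continuous `Q`, `F( · , γ)` is continuous in `A′` … [cite: MagnenRivasseauSeneor1993, (II.47) p.342] -/
theorem continuous_peakFactor (hQc : Continuous Q) (S Sγ : Finset Momentum) (lam : ℝ) (γ : GhostConfig) :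
    Continuous fun A' : Config => peakFactor Q S Sγ lam A' γ := by
  unfold peakFactor
  exact Real.continuous_exp.comp (hQc.comp (continuous_peakDeviation S Sγ lam γ)).neg

/-- … hence measurable … [cite: MagnenRivasseauSeneor1993, (II.47) p.342] -/
theorem measurable_peakFactor (hQc : Continuous Q) (S Sγ : Finset Momentum) (lam : ℝ) (γ : GhostConfig) :
    Measurable fun A' : Config => peakFactor Q S Sγ lam A' γ :=
  (continuous_peakFactor hQc S Sγ lam γ).measurable

/-- … and integrable against every finite measure on configurations (bounded by `1`).
[cite: MagnenRivasseauSeneor1993, (II.46)–(II.47) p.342] -/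
theorem integrable_peakFactor (hQ : ∀ X, 0 ≤ Q X) (hQc : Continuous Q) (S Sγ : Finset Momentum) (lam : ℝ)
    (γ : GhostConfig) (μ : Measure Config) [IsFiniteMeasure μ] :
    Integrable (fun A' => peakFactor Q S Sγ lam A' γ) μ := by
  refine Integrable.of_bound (C := 1) (measurable_peakFactor hQc S Sγ lam γ).aestronglyMeasurable
    (Filter.Eventually.of_forall fun A' => ?_)
  rw [Real.norm_eq_abs, abs_of_pos (peakFactor_pos Q S Sγ lam A' γ)]
  exact peakFactor_le_one hQ S Sγ lam A' γ

/-! ## §3 (II.46) `L_{0,ρ₁}(γ)` and the identity `1 = L_{0,ρ₁}(γ) ∫ dμ F(A′₀, γ)` -/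

variable (par : Parameters)

/-- The integral in (II.46), `∫ dμ F(A′₀, γ)`, against the tree's reference measure `muZeroPrime par ρ₁` on the
twelve-component `A′` (`dμ_{0,ρ₁}(A′)dμ_{C₀,ρ₁}(A′₀)`). [cite: MagnenRivasseauSeneor1993, (II.46) p.342, (II.44) p.341] -/
def peakIntegral (Q : ((Fin 4 → ℤ) → Fin 3 → ℂ) → ℝ) (ρ₁ : ℕ) (S Sγ : Finset Momentum) (lam : ℝ)
    (γ : GhostConfig) : ℝ :=
  ∫ A', peakFactor Q S Sγ lam A' γ ∂(muZeroPrime par ρ₁)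

/-- **(II.46), `L_{0,ρ₁}(γ)` := «the inverse of the integral in (II.46)»**.
[cite: MagnenRivasseauSeneor1993, (II.46) p.342 tl.12, tl.15–16] -/
def Lnorm (Q : ((Fin 4 → ℤ) → Fin 3 → ℂ) → ℝ) (ρ₁ : ℕ) (S Sγ : Finset Momentum) (lam : ℝ) (γ : GhostConfig) : ℝ :=
  (peakIntegral par Q ρ₁ S Sγ lam γ)⁻¹

/-- `0 < ∫ dμ F(A′₀, γ)`. [cite: MagnenRivasseauSeneor1993, (II.46) p.342] -/
theorem peakIntegral_pos (hQ : ∀ X, 0 ≤ Q X) (hQc : Continuous Q) (ρ₁ : ℕ) (S Sγ : Finset Momentum) (lam : ℝ)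
    (γ : GhostConfig) : 0 < peakIntegral par Q ρ₁ S Sγ lam γ := by
  unfold peakIntegral peakFactor
  exact integral_exp_pos (by
    have h := integrable_peakFactor hQ hQc S Sγ lam γ (muZeroPrime par ρ₁)
    unfold peakFactor at h
    exact h)

/-- `∫ dμ F(A′₀, γ) ≤ 1`. [cite: MagnenRivasseauSeneor1993, (II.46)–(II.47) p.342] -/
theorem peakIntegral_le_one (hQ : ∀ X, 0 ≤ Q X) (ρ₁ : ℕ) (S Sγ : Finset Momentum) (lam : ℝ) (γ : GhostConfig) :
    peakIntegral par Q ρ₁ S Sγ lam γ ≤ 1 := by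
  unfold peakIntegral
  calc ∫ A', peakFactor Q S Sγ lam A' γ ∂(muZeroPrime par ρ₁)
      ≤ ∫ _A', (1 : ℝ) ∂(muZeroPrime par ρ₁) := by
        refine integral_mono_of_nonneg (Filter.Eventually.of_forall fun A' => (peakFactor_pos Q S Sγ lam A' γ).le)
          (integrable_const 1) (Filter.Eventually.of_forall fun A' => peakFactor_le_one hQ S Sγ lam A' γ)
    _ = 1 := by simp

/-- `0 < L_{0,ρ₁}(γ)`. [cite: MagnenRivasseauSeneor1993, (II.46) p.342] -/
theorem Lnorm_pos (hQ : ∀ X, 0 ≤ Q X) (hQc : Continuous Q) (ρ₁ : ℕ) (S Sγ : Finset Momentum) (lam : ℝ)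
    (γ : GhostConfig) : 0 < Lnorm par Q ρ₁ S Sγ lam γ :=
  inv_pos.mpr (peakIntegral_pos par hQ hQc ρ₁ S Sγ lam γ)

/-- `1 ≤ L_{0,ρ₁}(γ)`. [cite: MagnenRivasseauSeneor1993, (II.46) p.342] -/
theorem one_le_Lnorm (hQ : ∀ X, 0 ≤ Q X) (hQc : Continuous Q) (ρ₁ : ℕ) (S Sγ : Finset Momentum) (lam : ℝ)
    (γ : GhostConfig) : 1 ≤ Lnorm par Q ρ₁ S Sγ lam γ :=
  one_le_inv_iff₀.mpr ⟨peakIntegral_pos par hQ hQc ρ₁ S Sγ lam γ, peakIntegral_le_one par hQ ρ₁ S Sγ lam γ⟩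

/-- **(II.46) PROVED: `L_{0,ρ₁}(γ) · ∫ dμ F(A′₀, γ) = 1`** — «L_{0,ρ₁} is the inverse of the integral in (II.46) so
that (II.46) is true», for every `γ`, every pair of windows, every `ρ₁`, every coupling and every nonnegative
continuous peaking exponent. [cite: MagnenRivasseauSeneor1993, (II.46) p.342 tl.12, tl.15–16] -/
theorem Lnorm_mul_peakIntegral (hQ : ∀ X, 0 ≤ Q X) (hQc : Continuous Q) (ρ₁ : ℕ) (S Sγ : Finset Momentum)
    (lam : ℝ) (γ : GhostConfig) : Lnorm par Q ρ₁ S Sγ lam γ * peakIntegral par Q ρ₁ S Sγ lam γ = 1 :=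
  inv_mul_cancel₀ (peakIntegral_pos par hQ hQc ρ₁ S Sγ lam γ).ne'

/-- (II.46) in the printed shape `1 = L_{0,ρ₁}(γ) ∫ dμ(A′) F(A′₀, γ)`. [cite: MagnenRivasseauSeneor1993, (II.46) p.342 tl.12] -/
theorem one_eq_Lnorm_mul_integral_peakFactor (hQ : ∀ X, 0 ≤ Q X) (hQc : Continuous Q) (ρ₁ : ℕ)
    (S Sγ : Finset Momentum) (lam : ℝ) (γ : GhostConfig) :
    (1 : ℝ) = Lnorm par Q ρ₁ S Sγ lam γ * ∫ A', peakFactor Q S Sγ lam A' γ ∂(muZeroPrime par ρ₁) :=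
  (Lnorm_mul_peakIntegral par hQ hQc ρ₁ S Sγ lam γ).symm

/-- The inserted factor `L_{0,ρ₁}(γ)F(A′₀, γ)` of (II.49) (last line) is a probability density in `A′` against `dμ`:
`∫ L_{0,ρ₁}(γ)F(A′₀, γ) dμ(A′) = 1`. [cite: MagnenRivasseauSeneor1993, (II.46) p.342, (II.49) p.342] -/
theorem integral_Lnorm_mul_peakFactor (hQ : ∀ X, 0 ≤ Q X) (hQc : Continuous Q) (ρ₁ : ℕ) (S Sγ : Finset Momentum)
    (lam : ℝ) (γ : GhostConfig) :
    ∫ A', Lnorm par Q ρ₁ S Sγ lam γ * peakFactor Q S Sγ lam A' γ ∂(muZeroPrime par ρ₁) = 1 := by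
  rw [integral_const_mul]
  exact Lnorm_mul_peakIntegral par hQ hQc ρ₁ S Sγ lam γ

end MainStatement

end Literature.MathematicalPhysics.QuantumFieldTheory.MagnenRivasseauSeneor1993
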